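import Summits.QuantumFields.YangMills.Theorems.BalabanUVNodesN07AtRecordCritPinned
import Literature.MathematicalPhysics.QuantumFieldTheory.Balaban1983to89.Node00.Record13CarriersCoP
import Literature.MathematicalPhysics.QuantumFieldTheory.Balaban1983to89.Node00.Record13CarriersSepCoP
import Literature.MathematicalPhysics.QuantumFieldTheory.Balaban1983to89.Node00.Record13LiveSelectorFamily
import Literature.MathematicalPhysics.QuantumFieldTheory.Balaban1983to89.B11LeafKnitProp9

/-!
# BalabanUVNodes ∕ N07 ([Balaban1985Variational], `Dag.B11_main`) AT THE STAGE-13 RECORD, v1.5 `CoP` EDITION — the KEY-23∕24T image of this seat's Co storey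
# `BalabanUVNodesN07AtRecord13Co` (p522100) at node00-def-T's FILE 23 `Node00/Record13CoP` (print's `ζ` and print's top domain `Ω₀`: `Stage13Params.toStage5₁₃CoP`,
# `datumOfRecord₁₃CoP (h : Provisos₁₃Core)`, `IsRecordOfRecord₁₃CCoP`; director-ym LINES №160–№166: «the LAST record edition before KEY-20», rev 20 keys ONCE on `CoP`)
# and FILE 24T `Node00/Record13SepCoP` (`Provisos₁₃SepCoP(.toCore)`, `datumOfRecord₁₃SepCoP`, `IsRecordOfRecord₁₃CSepCoP(.toCoP)`), over dag-n10-d's CoP carrier stack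
# `Node00/Record13CarriersCoP` (p522195: `view₁₃CoPB10YZW(_eq)`, `upOfRecord₅C_view₁₃CoPB10YZW_leaves`, `toStage5₁₃CoP_pin<G>`, `datumOfRecord₁₃CoP_pin<G> ∕ _rebindX`) and
# `Node00/Record13CarriersSepCoP` (`Provisos₁₃SepCoP.pin<G>`, `datumOfRecord₁₃SepCoP_pin<G>`) — Track A, DAG node N07 = Commun. Math. Phys. **102** (1985) 277–309, Thm 1 p. 279 +
# Props 2–9 pp. 281–309; seat `pub-ymgap-dag-n07-a` (KNIT-BY-NAME, FAN-OUT §N07 s2 «knit at the newest record»), generation 5, module 2, 2026-08-27.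

WHY THIS FILE.  Director-ym №160 (2)∕(5) + №162 (def-T Q1 = YES, «(y) DATUM-SIDE»): the v1.5 `CoP` edition re-seeds the U-cone, so `toStage5₁₃Co ∕ datumOfRecord₁₃Co ∕ IsRecordOfRecord₁₃CCo ∕
…SepCo` all received CoP twins (KEY-23∕24T token rule `Co ↦ CoP`, `Provisos₁₃Core` token-identical) and every Co-keyed storey re-keys ONCE; the K texts of route rev 20 (K1⁵) read
`Provisos₁₃SepCoP ∕ datumOfRecord₁₃SepCoP ∕ IsRecordOfRecord₁₃CSepCoP`.  p522100 (the Co storey) STANDS as a settled helper (№160 (5)); THIS module is its image under the token rule —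
statement SHAPES verbatim, proofs re-checked: N07's reading, the four-pin CoP-view faces (the key at which the K1 rung measures N07 under the AUDIT-A2b cure (a)), the ∃-currency at the
Core key (+ the v1.5 `SepCoP` twin = the edition K1⁵ reads), the witness line, the census, and AUDIT-A2b for N07 at the bare CoP key.  ONE difference of means: the presentation «a world
bound to the four-pin CoP view IS a ₁₃CCoP record of the same datum» is a PRIVATE lemma here (dag-n24-c's public `N24_isRecordOfRecord₁₃CCoP_of_up_view₁₃CoPB10YZW` is announced —
INTENT-12 — but not yet in the tree at typing time; one declarer: theirs).
CONTENT consumed BY NAME, nothing restated — the `CoP` images of p522100's by-name inputs (its header lists them): def-T FILE 23 ∕ 24T (+ `atWorld_of_ ∕ exists_world_isRecordOfRecord₁₃CCoP`),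
dag-n10-d's CoP ∕ SepCoP carrier stacks (+ the token-identical `Provisos₁₃Core.pin<G> ∕ .rebindX`, `rebindX_admissible_iff`, `pin<G>_admissible_iff`), node00-def-K0a's witness line
`theta13LiveOfRecord` + its HYPOTHESIS-FREE guard, dag-n07-e's record-free leaf closers `b11Leaf_Z11OfRecord_pinCrit_of_prop7_leaves ∕ _withSectE_pinCrit_of_parts` (p465289), g30's
`Node00/CarriersZ` (`G8a_of_b11Leaf_Z11OfRecord`, `exists_thm1At_of_…`, `exists_residZ_not_b11Leaf`, `nonempty_residZ`), `B11LeafUnpinnedRecord`, `B11LeafKnitProp9.b11Leaf_of_isEmpty`,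
dag-n22-b's `exists_junkOps_b9LeafX_Y9OfRecord`, `CarriersW.nonempty_residW`.  THEOREMS ONLY (0 `def`, 0 `sorry`, 0 `instance`, standard axioms); COUNT-NEUTRAL; filed
`--kind proof --supports stmt-QuantumFields-20294 --as helper` (K1⁵ `StabilityBAtRecordR13SepCoP`, route rev 20∕21 — plan KEY-20 l.18802, dag-lead WORDS-141; a helper link, not a stub body).

WHAT IS PROVED = the `Co ↦ CoP` images of p522100's 26 theorems, same section plan (bookkeeping BY NAME; one `exact` ∕ `obtain` each): §0 readings at the Core key
(`b11_main_iff_leaves_of_isRecordOfRecord₁₃CCoP ∕ …CSepCoP`, `s_N07_iff_leaves₁₃CCoP`); §1 the four-pin CoP-view faces (`b11_iff_leaf_of_up_view₁₃CoPB10YZW`, ★ the composable face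
`b11_main_at_view₁₃CoPB10YZW_of_leaf`, `b11_main_iff_at_…`, `leaf_of_b11_main_at_…`, ★ `G8a_of_b11_at_view₁₃CoPB10YZW` = the MEASURED content); §2 the ∃-currency at the Core key
(`exists_record₁₃CCoP_b11_main_of_leaf` + `…_pinCrit_of_prop7_leaves ∕ …_withSectE_pinCrit_of_parts`, ★ `exists_isRecordOfRecord₁₃CCoP_b11_main_of_leaf`,
★ `exists_guarded_record₁₃CCoP_b11_main_of_inhabited13Core(_two)`, ★ `exists_record₁₃CSepCoP_b11_main_of_leaf` = the v1.5 edition K1⁵ reads); §3 the witness line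
(`exists_record₁₃CCoP_b11_main_at_theta13LiveOfRecord`, `exists_guarded_record₁₃CCoP_b11_main_of_theta13Live_provisosCore_two`); §4 census (`exists_record₁₃CCoP_faces`,
`b11Leaf_of_ ∕ thm1_family_of_s_N07_record₁₃CCoP`, ★ `not_s_N07_record₁₃CCoP_of_params`, `exists_record₁₃CCoP_not_b11_main`, `not_s_N07_record₁₃CCoP`, ★ `exists_record₁₃CCoP_b11_main_iff_leaf`);
§5 AUDIT-A2b at the bare CoP key (`exists_record₁₃CCoP_b11_main_of_pinZ_empty`, ★ `b11_main_undetermined_over_record₁₃CCoP`).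
HONEST FRAMING.  Kernel bookkeeping BY NAME (a token image of a landed storey); NO estimate of [Balaban1985Variational] is proved here; Theorem 1 for `k ≥ 1` is proved NOWHERE in the
tree (GAPS G₈a-1∕2); every printed statement and Sect.-F leaf stays a DISPLAYED hypothesis of the §2 consumers; NOT a discharge of N07 (5∕27 untouched); K0 ∕ K1 neither proved nor
assumed; object-level-unpinned in the [B11] group: `ζ.R` (F8), `famAn`.  One finite four-torus programme at fixed `ε` per run — NOT ℝ⁴, NOT OS, NOT a mass gap, NOT Clay. -/

noncomputable section

namespace Summit.QuantumFields.YangMills.BalabanUVNodes.N07AtRecord13CoP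

open Literature.MathematicalPhysics.QuantumFieldTheory.Balaban1983to89
open Literature.MathematicalPhysics.QuantumFieldTheory.Balaban1983to89.T4Continuum (T4Family FiniteEpsData)
open Literature.MathematicalPhysics.QuantumFieldTheory.Balaban1983to89.DagBinding
open Literature.MathematicalPhysics.QuantumFieldTheory.Balaban1983to89.Node00
open Literature.MathematicalPhysics.QuantumFieldTheory.Balaban1983to89.B11Thm1 (Thm1At)
open Literature.MathematicalPhysics.QuantumFieldTheory.Balaban1983to89.B11Thm1CarrierT (RegCarrierT varProblemT)
open Literature.MathematicalPhysics.QuantumFieldTheory.Balaban1983to89.B11SectFAssembly (CubeData Leaves)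
open YMDAG.UVSplit (RecordPred Datum AtRecord S_N07)
open Summit.QuantumFields.YangMills.BalabanUVNodes.N06AtRecord9CB10Y (exists_junkOps_b9LeafX_Y9OfRecord)
open Summit.QuantumFields.YangMills.BalabanUVNodes.N07AtRecordCritPinned
  (b11Leaf_Z11OfRecord_pinCrit_of_prop7_leaves b11Leaf_Z11OfRecord_withSectE_pinCrit_of_parts)
open scoped Matrix.Norms.L2Operator

variable {N : ℕ} [NeZero N] {F : T4Family} {D : FiniteEpsData F (Node00.SU N)} {w : WorldP}

/-! ## §0 Readings at the Core ∕ CoP record `IsRecordOfRecord₁₃CCoP` (bare key: world bound to `θ.toStage5₁₃CoP`) -/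
/-- **At every run of a ₁₃CCoP record N07 IS «b8 → b9 → b11»** (the in-edges `b4 b5 b6 b7` are theorems of the record: `B11LeafUnpinnedRecord.b11_main_iff_of_isRecordOfRecord₅C` along
def-T's `atWorld_of_isRecordOfRecord₁₃CCoP`). [cite: Balaban1985Variational, Thm 1 p.279, Props 2–9 pp.281–309 (bookkeeping: the node at a record)] -/
theorem b11_main_iff_leaves_of_isRecordOfRecord₁₃CCoP (h : IsRecordOfRecord₁₃CCoP F N D w) (P : B12.RunParams) :
    Dag.B11_main (leavesP w P) ↔ ((leavesP w P).b8 → (leavesP w P).b9 → (leavesP w P).b11) :=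
  atWorld_of_isRecordOfRecord₁₃CCoP (X := fun ℓ => Dag.B11_main ℓ ↔ (ℓ.b8 → ℓ.b9 → ℓ.b11))
    (fun _ _ h5 P => B11LeafUnpinnedRecord.b11_main_iff_of_isRecordOfRecord₅C h5 P) h P

/-- **… and at every run of a v1.5 `SepCoP` record** (along FILE 24T's one-way projection `IsRecordOfRecord₁₃CSepCoP.toCoP`). [cite: Balaban1985Variational, Thm 1 p.279 (bookkeeping)] -/
theorem b11_main_iff_leaves_of_isRecordOfRecord₁₃CSepCoP (h : IsRecordOfRecord₁₃CSepCoP F N D w) (P : B12.RunParams) :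
    Dag.B11_main (leavesP w P) ↔ ((leavesP w P).b8 → (leavesP w P).b9 → (leavesP w P).b11) :=
  b11_main_iff_leaves_of_isRecordOfRecord₁₃CCoP h.toCoP P

/-- **`S_N07` over the CoP record predicate IS «`b8 → b9 → b11` at every run of every CoP record»**. [cite: Balaban1985Variational, Thm 1 p.279, Props 2–9 pp.281–309 (bookkeeping)] -/
theorem s_N07_iff_leaves₁₃CCoP : S_N07 (fun F D w => IsRecordOfRecord₁₃CCoP F N D w) ↔
      ∀ (F : T4Family) (D : Datum F N) (w : WorldP), IsRecordOfRecord₁₃CCoP F N D w →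
        ∀ P : B12.RunParams, (leavesP w P).b8 → (leavesP w P).b9 → (leavesP w P).b11 :=
  ⟨fun h F D w hR P => (b11_main_iff_leaves_of_isRecordOfRecord₁₃CCoP hR P).1 (h F D w hR P),
    fun h F D w hR P => (b11_main_iff_leaves_of_isRecordOfRecord₁₃CCoP hR P).2 (h F D w hR P)⟩

/-! ## §1 At a world bound to dag-n10-d's four-pin CoP view `θ.view₁₃CoPB10YZW M⋆ ops ζ λW` — THE KEY AT WHICH THE RUNG MEASURES N07 -/
section View

variable (θ : Stage13Params F N) (Mstar : ℕ) (ops : OpsY N θ.toStage3Params Mstar) (ζ : ResidZ F N) (lamW : ResidW F N)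

/-- **The four-pin world's `b11` IS the [B11] leaf at the bundle of record of the presenting layer `ζ`** (n10-d's `upOfRecord₅C_view₁₃CoPB10YZW_leaves`). [cite: Balaban1985Variational, Thm 1 p.279, Props 2–9 pp.281–309 (the leaf, by name)] -/
theorem b11_iff_leaf_of_up_view₁₃CoPB10YZW (hup : ∀ P, w.up P = upOfRecord₅C F N (θ.view₁₃CoPB10YZW F N Mstar ops ζ lamW) P) (P : B12.RunParams) :
    (leavesP w P).b11 ↔ B11Leaf (Z11OfRecord F N ζ) := by
  show (w.up P).b11 ↔ _
  rw [hup P]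
  exact (upOfRecord₅C_view₁₃CoPB10YZW_leaves F N θ Mstar ops ζ lamW P).2.2.2

/-- ★ **THE COMPOSABLE FACE FOR THE K1 KNIT AT STAGE 13**: for ANY world bound to the four-pin CoP view presenting `ζ`, the [B11] leaf at `Z11OfRecord F N ζ` gives `Dag.B11_main` at every
run (in-edges unused) — what a knitter applies at the ONE world carrying all thirteen nodes (₁₃CoP twin of p468384's `b11_main_at_view₁₂B10YZW_of_leaf`). [cite: Balaban1985Variational, Thm 1 p.279, Props 2–9 pp.281–309 (bookkeeping: the node at the four-pin view)] -/
theorem b11_main_at_view₁₃CoPB10YZW_of_leaf (hup : ∀ P, w.up P = upOfRecord₅C F N (θ.view₁₃CoPB10YZW F N Mstar ops ζ lamW) P)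
    (hleaf : B11Leaf (Z11OfRecord F N ζ)) (P : B12.RunParams) : Dag.B11_main (leavesP w P) :=
  fun _ _ _ _ _ => (b11_iff_leaf_of_up_view₁₃CoPB10YZW θ Mstar ops ζ lamW hup P).2 hleaf

/-- **N07 AT A FOUR-PIN-BOUND WORLD THAT IS A Co RECORD READS «b8 → b9 → leaf at `ζ`»** (in-edges `b4 … b7` theorems of the record). [cite: Balaban1985Variational, Thm 1 p.279, Props 2–9 pp.281–309 (bookkeeping)] -/
theorem b11_main_iff_at_view₁₃CoPB10YZW (hrec : IsRecordOfRecord₁₃CCoP F N D w)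
    (hup : ∀ P, w.up P = upOfRecord₅C F N (θ.view₁₃CoPB10YZW F N Mstar ops ζ lamW) P) (P : B12.RunParams) :
    Dag.B11_main (leavesP w P) ↔ ((leavesP w P).b8 → (leavesP w P).b9 → B11Leaf (Z11OfRecord F N ζ)) := by
  rw [b11_main_iff_leaves_of_isRecordOfRecord₁₃CCoP hrec P, b11_iff_leaf_of_up_view₁₃CoPB10YZW θ Mstar ops ζ lamW hup P]

/-- **… so N07 at a run of such a world whose in-edges hold FORCES the leaf at `ζ`** (the rung's N07 conjunct read back). [cite: Balaban1985Variational, Thm 1 p.279 (bookkeeping)] -/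
theorem leaf_of_b11_main_at_view₁₃CoPB10YZW (hrec : IsRecordOfRecord₁₃CCoP F N D w)
    (hup : ∀ P, w.up P = upOfRecord₅C F N (θ.view₁₃CoPB10YZW F N Mstar ops ζ lamW) P) {P : B12.RunParams} (hN : Dag.B11_main (leavesP w P))
    (h8 : (leavesP w P).b8) (h9 : (leavesP w P).b9) : B11Leaf (Z11OfRecord F N ζ) :=
  (b11_main_iff_at_view₁₃CoPB10YZW θ Mstar ops ζ lamW hrec hup P).1 hN h8 h9

/-- ★ **WHAT THE MEASURED CONJUNCT GIVES** (AUDIT-A2b for N07, positive half): the four-pin world's [B11] bundle is `Z11OfRecord F N ζ` over the INHABITED `ZIdx`, so its `b11` is never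
vacuous: it hands def-B's Stage-₈ letters `UkExistsR ∧ UniqueUkOrbitR F N (regB11 F N)` on every torus, level `k ≤ K`, radius `B₃ε₁`, `0 < ε₁ ≤ a₁`, `V` with (7) (g30's `G8a_of_b11Leaf_Z11OfRecord`). [cite: Balaban1985Variational, Thm 1 p.279; Balaban1987RG1, (1.1)–(1.2) p.260] -/
theorem G8a_of_b11_at_view₁₃CoPB10YZW (hup : ∀ P, w.up P = upOfRecord₅C F N (θ.view₁₃CoPB10YZW F N Mstar ops ζ lamW) P) {P : B12.RunParams}
    (hb : (leavesP w P).b11) :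
    ∃ C : B11Thm1.Consts, ∀ (K k : ℕ), k ≤ K → ∀ ε₁ : ℝ, 0 < ε₁ → ε₁ ≤ C.a₁ → ∀ V : GaugeField (F.P K) k (SU N), PlaqSmall ε₁ V →
      UkExistsR F N (regB11 F N) K k (C.B₃ * ε₁) V ∧ UniqueUkOrbitR F N (regB11 F N) K k (C.B₃ * ε₁) V :=
  G8a_of_b11Leaf_Z11OfRecord ((b11_iff_leaf_of_up_view₁₃CoPB10YZW θ Mstar ops ζ lamW hup P).1 hb)

end View

/-! ## §2 The ∃-currency at the Core ∕ CoP key — real Stage-13 runs modulo Core inhabitation, N07 ALONE -/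
/-- (private; dag-n24-c's public twin `N24_isRecordOfRecord₁₃CCoP_of_up_view₁₃CoPB10YZW` is the declarer of record once landed) **A world bound to the four-pin CoP view over
`(datumOfRecord₁₃CoP θ hP).C` IS a ₁₃CCoP record of the same datum** (presenting parameter the quadruply pinned `θ`: dag-n10-d's `view₁₃CoPB10YZW_eq`, `Provisos₁₃Core.pin<G>`,
`pin<G>_admissible_iff`, `datumOfRecord₁₃CoP_pin<G>`). [cite: Balaban1989LargeFieldII, Thm 1 + (0.1) pp.355–356 (bookkeeping)] -/
private theorem isRecordOfRecord₁₃CCoP_of_up_view₁₃CoPB10YZW (θ : Stage13Params F N) (hP : θ.Provisos₁₃Core F N) (hθ : θ.Admissible F N)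
    (Mstar : ℕ) (ops : OpsY N θ.toStage3Params Mstar) (ζ : ResidZ F N) (lamW : ResidW F N) (w : WorldP)
    (hC : w.C = (datumOfRecord₁₃CoP F N θ hP).C) (hγ : 0 < w.γ ∧ w.γ ≤ θ.γ) (hL : w.L = (θ.L : ℝ))
    (hup : ∀ P, w.up P = upOfRecord₅C F N (θ.view₁₃CoPB10YZW F N Mstar ops ζ lamW) P) :
    IsRecordOfRecord₁₃CCoP F N (datumOfRecord₁₃CoP F N θ hP) w := by
  refine ⟨(((θ.pinB10 F N).pinY F N (Y9OfRecord N θ.toStage3Params Mstar ops)).pinZ F N (Z11OfRecord F N ζ)).pinW F N (WOfRecord₁₃ F N θ lamW),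
    ((hP.pinB10.pinY (Y9OfRecord N θ.toStage3Params Mstar ops)).pinZ (Z11OfRecord F N ζ)).pinW (WOfRecord₁₃ F N θ lamW),
    (Stage13Params.pinW_admissible_iff F N _ _).2 ((Stage13Params.pinZ_admissible_iff F N _ _).2
      ((Stage13Params.pinY_admissible_iff F N _ _).2 ((Stage13Params.pinB10_admissible_iff F N θ).2 hθ))), ?_, hC, hγ, hL, fun P => ?_⟩
  · exact (datumOfRecord₁₃CoP_pinB10 F N θ hP).symm.trans
      ((datumOfRecord₁₃CoP_pinY F N (θ.pinB10 F N) hP.pinB10 (Y9OfRecord N θ.toStage3Params Mstar ops)).symm.trans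
        ((datumOfRecord₁₃CoP_pinZ F N _ (hP.pinB10.pinY (Y9OfRecord N θ.toStage3Params Mstar ops)) (Z11OfRecord F N ζ)).symm.trans
          (datumOfRecord₁₃CoP_pinW F N _ ((hP.pinB10.pinY (Y9OfRecord N θ.toStage3Params Mstar ops)).pinZ (Z11OfRecord F N ζ))
            (WOfRecord₁₃ F N θ lamW)).symm))
  · rw [hup P, Stage13Params.view₁₃CoPB10YZW_eq]

/-- **THE ∃-DIRECTION AT THE CoP RECORD**: every admissible Stage-13 parameter with the CORE provisos, any window `0 < γw ≤ θ.γ`, every floor, operator layer, [IV] layer and a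
[B11] layer `ζ` CARRYING THE LEAF present a ₁₃CCoP record of `datumOfRecord₁₃CoP θ h` — the world bound to the four-pin CoP view (presenting parameter the quadruply pinned `θ`) — at every
run of which N07 HOLDS. [cite: Balaban1985Variational, Thm 1 p.279, Props 2–9 pp.281–309 (bookkeeping: the node at the ₁₃ record)] -/
theorem exists_record₁₃CCoP_b11_main_of_leaf (θ : Stage13Params F N) (h : θ.Provisos₁₃Core F N) (hθ : θ.Admissible F N) {γw : ℝ} (hγw : 0 < γw ∧ γw ≤ θ.γ)
    (Mstar : ℕ) (ops : OpsY N θ.toStage3Params Mstar) (ζ : ResidZ F N) (lamW : ResidW F N) (hleaf : B11Leaf (Z11OfRecord F N ζ)) :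
    ∃ w : WorldP, IsRecordOfRecord₁₃CCoP F N (datumOfRecord₁₃CoP F N θ h) w ∧ w.γ = γw ∧ w.L = (θ.L : ℝ) ∧
      (∀ P, w.up P = upOfRecord₅C F N (θ.view₁₃CoPB10YZW F N Mstar ops ζ lamW) P) ∧ ∀ P : B12.RunParams, Dag.B11_main (leavesP w P) := by
  obtain ⟨w₀⟩ := nonempty_worldP
  refine ⟨{ w₀ with
      C := (datumOfRecord₁₃CoP F N θ h).C, γ := γw, L := (θ.L : ℝ), one_lt_L := by exact_mod_cast θ.hL.2,
      up := fun P => upOfRecord₅C F N (θ.view₁₃CoPB10YZW F N Mstar ops ζ lamW) P }, ?_, rfl, rfl, fun _ => rfl, fun P => ?_⟩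
  · exact isRecordOfRecord₁₃CCoP_of_up_view₁₃CoPB10YZW θ h hθ Mstar ops ζ lamW _ rfl hγw rfl (fun _ => rfl)
  · exact b11_main_at_view₁₃CoPB10YZW_of_leaf θ Mstar ops ζ lamW (fun _ => rfl) hleaf P

/-- **THE STAGE-13 CONSUMER AT THE CRIT-PINNED LAYER, PRINT's PROP-7 DAG** — Props 2–7, 9 + r08's located Sect.-F leaves at `ζ.pinCrit` (dag-n07-e's `b11Leaf_Z11OfRecord_pinCrit_of_prop7_leaves`;
NO `hloc`, NO `hcrit`) ⇒ N07 HOLDS at every run of a ₁₃CCoP record of `datumOfRecord₁₃CoP θ h` presented with `ζ.pinCrit`.  NOT a discharge. [cite: Balaban1985Variational, Thm 1 p.279, Props 2–9 pp.281–309, Sect. F (144)–(169) pp.300–305] -/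
theorem exists_record₁₃CCoP_b11_main_pinCrit_of_prop7_leaves (θ : Stage13Params F N) (h : θ.Provisos₁₃Core F N) (hθ : θ.Admissible F N)
    {γw : ℝ} (hγw : 0 < γw ∧ γw ≤ θ.γ) (Mstar : ℕ) (ops : OpsY N θ.toStage3Params Mstar) (lamW : ResidW F N) (ζ : ResidZ F N)
    (Dc : ∀ i : ZIdx, CubeData (famXOfRecord F N ζ.pinCrit i))
    {d L B₂ K R₁M₁ a₃ a₄ : ℝ} (hLv : ∀ i, Leaves (famXOfRecord F N ζ.pinCrit i) (Dc i) d L ζ.B₁ B₂ ζ.B₃ K R₁M₁ ζ.c₁ a₃ a₄)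
    (hd : 1 ≤ d) (hL : 0 < L) (hB₂ : 0 < B₂) (hK : 0 < K) (hR : 1 ≤ R₁M₁) (ha₃ : 0 < a₃) (ha₄ : 0 < a₄)
    (hB₁ : 0 < ζ.B₁) (hB₃ : 0 < ζ.B₃) (hC₁ : 0 < ζ.C₁) (hc₁ : 0 < ζ.c₁)
    (p2 : B11.Prop2Printed ζ.B₁ ζ.B₃ ζ.C₁ ζ.c₁ ζ.famLG) (p3 : B11.Prop3Printed ζ.C₁ ζ.B₃ ζ.C₂ ζ.C₃ ζ.B₀ ζ.c1h ζ.c₄ ζ.δ₀ ζ.famLG)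
    (p4 : B11.Prop4Printed ζ.C₁ ζ.B₃ ζ.famLG) (p5 : B11.Prop5Printed ζ.B₁ ζ.B₃ ζ.C₁ ζ.famLG) (p6 : B11.Prop6Printed ζ.B₀ ζ.B₃ ζ.C₁ ζ.famLG)
    (p7 : B11.Prop7Printed ζ.B₃ ζ.C₁ (famXOfRecord F N ζ.pinCrit)) (p9 : B11.Prop9Printed ζ.B₅ ζ.C₁ ζ.β₀ ζ.δ₀ ζ.famAn) :
    ∃ w : WorldP, IsRecordOfRecord₁₃CCoP F N (datumOfRecord₁₃CoP F N θ h) w ∧ ∀ P : B12.RunParams, Dag.B11_main (leavesP w P) := by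
  obtain ⟨w, hR, -, -, -, hN⟩ := exists_record₁₃CCoP_b11_main_of_leaf θ h hθ hγw Mstar ops ζ.pinCrit lamW
    (b11Leaf_Z11OfRecord_pinCrit_of_prop7_leaves ζ Dc hLv hd hL hB₂ hK hR ha₃ ha₄ hB₁ hB₃ hC₁ hc₁ p2 p3 p4 p5 p6 p7 p9)
  exact ⟨w, hR, hN⟩

section Doubly

variable {L : ℝ} {η : ZIdx → ℝ} [Fact (0 < L)] [∀ i, Fact (0 < η i)] {β : ZIdx → Type} [∀ i, Fintype (β i)]

/-- **THE STAGE-13 CONSUMER AT THE DOUBLY-PINNED LAYER `(ζ.withSectE E).pinCrit`** — SEVEN printed statements (Props 2, 3, 5, 7, 8, Sect. F, Prop. 9) + the letters' positivity (dag-n07-e's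
`b11Leaf_Z11OfRecord_withSectE_pinCrit_of_parts`; p4 ∕ p6 ∕ hcrit THEOREMS) ⇒ N07 HOLDS at every run of a ₁₃CCoP record of `datumOfRecord₁₃CoP θ h` presented with that layer.  NOT a discharge. [cite: Balaban1985Variational, Thm 1 p.279, Props 2–9 pp.281–309] -/
theorem exists_record₁₃CCoP_b11_main_withSectE_pinCrit_of_parts (θ : Stage13Params F N) (h : θ.Provisos₁₃Core F N) (hθ : θ.Admissible F N)
    {γw : ℝ} (hγw : 0 < γw ∧ γw ≤ θ.γ) (Mstar : ℕ) (ops : OpsY N θ.toStage3Params Mstar) (lamW : ResidW F N) (ζ : ResidZ F N) (E : SectEPres F N L η β ζ)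
    (hC₄ : 0 < E.C₄) (ha₃ : 0 < E.a₃) (hα : 0 < E.α) (hB₀ : 0 < ζ.B₀) (hB₃ : 0 < ζ.B₃) (hC₁ : 0 < ζ.C₁)
    (p2 : B11.Prop2Printed ζ.B₁ ζ.B₃ ζ.C₁ ζ.c₁ (ζ.withSectE E).famLG) (p3 : B11.Prop3Printed ζ.C₁ ζ.B₃ ζ.C₂ ζ.C₃ ζ.B₀ ζ.c1h ζ.c₄ ζ.δ₀ (ζ.withSectE E).famLG)
    (p5 : B11.Prop5Printed ζ.B₁ ζ.B₃ ζ.C₁ (ζ.withSectE E).famLG)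
    (p7 : B11.Prop7Printed ζ.B₃ ζ.C₁ (famXOfRecord F N (ζ.withSectE E).pinCrit)) (p8 : B11.Prop8Printed ζ.B₃ (famXOfRecord F N (ζ.withSectE E).pinCrit))
    (sF : B11.SectFPrinted ζ.B₃ (famXOfRecord F N (ζ.withSectE E).pinCrit)) (p9 : B11.Prop9Printed ζ.B₅ ζ.C₁ ζ.β₀ ζ.δ₀ ζ.famAn) :
    ∃ w : WorldP, IsRecordOfRecord₁₃CCoP F N (datumOfRecord₁₃CoP F N θ h) w ∧ ∀ P : B12.RunParams, Dag.B11_main (leavesP w P) := by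
  obtain ⟨w, hR, -, -, -, hN⟩ := exists_record₁₃CCoP_b11_main_of_leaf θ h hθ hγw Mstar ops _ lamW
    (b11Leaf_Z11OfRecord_withSectE_pinCrit_of_parts ζ E hC₄ ha₃ hα hB₀ hB₃ hC₁ p2 p3 p5 p7 p8 sF p9)
  exact ⟨w, hR, hN⟩

end Doubly

/-- ★ **THE ∃-FORM SERVED AT THE PIN, N07's CONJUNCT**: if the CoP-CORE record class is inhabited at `F` (`∃ D w, IsRecordOfRecord₁₃CCoP F N D w` — K1⁵'s antecedent implies it along `.toCoP`; HYPOTHESIS) and the [B11] leaf holds at the bundle of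
record of SOME `ζ`, then SOME ₁₃CCoP record `(D, w′)` — the given datum, its world RE-BOUND to the four-pin CoP view presenting `ζ` (floor `0`, junk `ops`, any [IV] layer) — carries `Dag.B11_main` at every run.  N07 ALONE. [cite:
Balaban1985Variational, Thm 1 p.279, Props 2–9 pp.281–309; Balaban1989LargeFieldII, Thm 1 + (0.1) pp.355–356 (bookkeeping)] -/
theorem exists_isRecordOfRecord₁₃CCoP_b11_main_of_leaf (F : T4Family) (hK0 : ∃ (D : Datum F N) (w : WorldP), IsRecordOfRecord₁₃CCoP F N D w)
    (ζ : ResidZ F N) (hleaf : B11Leaf (Z11OfRecord F N ζ)) :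
    ∃ (D : Datum F N) (w : WorldP), IsRecordOfRecord₁₃CCoP F N D w ∧ ∀ P : B12.RunParams, Dag.B11_main (leavesP w P) := by
  obtain ⟨D, w, θ, h, hθ, hD, -, hγ, -⟩ := hK0
  obtain ⟨ops, -, -⟩ := exists_junkOps_b9LeafX_Y9OfRecord (N := N) θ.toStage3Params hθ.1.1.1.1.1.1 0
  obtain ⟨lamW⟩ := nonempty_residW F N
  obtain ⟨w', hR, -, -, -, hN⟩ := exists_record₁₃CCoP_b11_main_of_leaf θ h hθ (γw := w.γ) hγ 0 ops ζ lamW hleaf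
  exact ⟨D, w', hD ▸ hR, hN⟩

/-- ★ **N07's CONJUNCT SHAPE OF A CORE-KEYED NODES-∃, WITNESSED AT `θ` ITSELF**: from «∃ θ, Provisos₁₃Core ∧ (ZtUnity ∧ SlotsNondegenerate₁₃) ∧ Admissible» at the family and the [B11] leaf at SOME `ζ` — a θ with Core provisos, guard and admissibility
(read AT `θ`; the presenting quadruply-pinned parameter hidden in the record) and a ₁₃CCoP record of its datum carrying N07 at every run. [cite: Balaban1985Variational, Thm 1 p.279, Props 2–9 pp.281–309; Balaban1988Convergent, (3.16)–(3.22)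
pp.268–269 (the guard; bookkeeping)] -/
theorem exists_guarded_record₁₃CCoP_b11_main_of_inhabited13Core
    (hK0 : ∃ θ : Stage13Params F N, θ.Provisos₁₃Core F N ∧ (θ.ZtUnity F N ∧ θ.SlotsNondegenerate₁₃ F N) ∧ θ.Admissible F N)
    (ζ : ResidZ F N) (hleaf : B11Leaf (Z11OfRecord F N ζ)) :
    ∃ (θ : Stage13Params F N) (h : θ.Provisos₁₃Core F N) (w : WorldP), (θ.ZtUnity F N ∧ θ.SlotsNondegenerate₁₃ F N) ∧ θ.Admissible F N ∧
      IsRecordOfRecord₁₃CCoP F N (datumOfRecord₁₃CoP F N θ h) w ∧ ∀ P : B12.RunParams, Dag.B11_main (leavesP w P) := by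
  obtain ⟨θ, h, hU, hθ⟩ := hK0
  obtain ⟨ops, -, -⟩ := exists_junkOps_b9LeafX_Y9OfRecord (N := N) θ.toStage3Params hθ.1.1.1.1.1.1 0
  obtain ⟨lamW⟩ := nonempty_residW F N
  obtain ⟨w, hR, -, -, -, hN⟩ := exists_record₁₃CCoP_b11_main_of_leaf θ h hθ (γw := θ.γ) ⟨hθ.1.1.1.1.1.2, le_rfl⟩ 0 ops ζ lamW hleaf
  exact ⟨θ, h, w, hU, hθ, hR, hN⟩

/-- **… at `N = 2`** (the group of record `SU(2)`; K1's family-keyed ∃-shape with `Nodes` replaced by its N07 conjunct). [cite: Balaban1985Variational, Thm 1 p.279, Props 2–9 pp.281–309 (bookkeeping)] -/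
theorem exists_guarded_record₁₃CCoP_b11_main_of_inhabited13Core_two (F : T4Family)
    (hK0 : ∃ θ : Stage13Params F 2, θ.Provisos₁₃Core F 2 ∧ (θ.ZtUnity F 2 ∧ θ.SlotsNondegenerate₁₃ F 2) ∧ θ.Admissible F 2)
    (ζ : ResidZ F 2) (hleaf : B11Leaf (Z11OfRecord F 2 ζ)) :
    ∃ (θ : Stage13Params F 2) (h : θ.Provisos₁₃Core F 2) (w : WorldP), (θ.ZtUnity F 2 ∧ θ.SlotsNondegenerate₁₃ F 2) ∧ θ.Admissible F 2 ∧
      IsRecordOfRecord₁₃CCoP F 2 (datumOfRecord₁₃CoP F 2 θ h) w ∧ ∀ P : B12.RunParams, Dag.B11_main (leavesP w P) :=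
  exists_guarded_record₁₃CCoP_b11_main_of_inhabited13Core hK0 ζ hleaf

/-- ★ **THE v1.5 TWIN = THE EDITION K1⁵ READS** (def-T FILE 24T; dag-n10-d's `Record13CarriersSepCoP` pins `Provisos₁₃SepCoP.pin<G>`, `datumOfRecord₁₃SepCoP_pin<G>`): every admissible θ
with the v1.5 provisos, any window, floor, `ops`, `λW` and a [B11] layer `ζ` carrying the leaf present a ₁₃CSepCoP record of `datumOfRecord₁₃SepCoP θ h` bound to the four-pin CoP view,
N07 at every run. [cite: Balaban1985Variational, Thm 1 p.279, Props 2–9 pp.281–309; Balaban1989LargeFieldII, Thm 1 + (0.1) pp.355–356 (bookkeeping)] -/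
theorem exists_record₁₃CSepCoP_b11_main_of_leaf (θ : Stage13Params F N) (h : θ.Provisos₁₃SepCoP F N) (hθ : θ.Admissible F N) {γw : ℝ} (hγw : 0 < γw ∧ γw ≤ θ.γ)
    (Mstar : ℕ) (ops : OpsY N θ.toStage3Params Mstar) (ζ : ResidZ F N) (lamW : ResidW F N) (hleaf : B11Leaf (Z11OfRecord F N ζ)) :
    ∃ w : WorldP, IsRecordOfRecord₁₃CSepCoP F N (datumOfRecord₁₃SepCoP F N θ h) w ∧ w.γ = γw ∧ w.L = (θ.L : ℝ) ∧
      (∀ P, w.up P = upOfRecord₅C F N (θ.view₁₃CoPB10YZW F N Mstar ops ζ lamW) P) ∧ ∀ P : B12.RunParams, Dag.B11_main (leavesP w P) := by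
  obtain ⟨w₀⟩ := nonempty_worldP
  refine ⟨{ w₀ with
      C := (datumOfRecord₁₃SepCoP F N θ h).C, γ := γw, L := (θ.L : ℝ), one_lt_L := by exact_mod_cast θ.hL.2,
      up := fun P => upOfRecord₅C F N (θ.view₁₃CoPB10YZW F N Mstar ops ζ lamW) P }, ?_, rfl, rfl, fun _ => rfl, fun P => ?_⟩
  · refine ⟨(((θ.pinB10 F N).pinY F N (Y9OfRecord N θ.toStage3Params Mstar ops)).pinZ F N (Z11OfRecord F N ζ)).pinW F N (WOfRecord₁₃ F N θ lamW),
      ((h.pinB10.pinY (Y9OfRecord N θ.toStage3Params Mstar ops)).pinZ (Z11OfRecord F N ζ)).pinW (WOfRecord₁₃ F N θ lamW),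
      (Stage13Params.pinW_admissible_iff F N _ _).2 ((Stage13Params.pinZ_admissible_iff F N _ _).2
        ((Stage13Params.pinY_admissible_iff F N _ _).2 ((Stage13Params.pinB10_admissible_iff F N θ).2 hθ))), ?_, rfl, hγw, rfl, fun P => ?_⟩
    · exact (datumOfRecord₁₃SepCoP_pinB10 F N θ h).symm.trans
        ((datumOfRecord₁₃SepCoP_pinY F N (θ.pinB10 F N) h.pinB10 (Y9OfRecord N θ.toStage3Params Mstar ops)).symm.trans
          ((datumOfRecord₁₃SepCoP_pinZ F N _ (h.pinB10.pinY (Y9OfRecord N θ.toStage3Params Mstar ops)) (Z11OfRecord F N ζ)).symm.trans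
            (datumOfRecord₁₃SepCoP_pinW F N _ ((h.pinB10.pinY (Y9OfRecord N θ.toStage3Params Mstar ops)).pinZ (Z11OfRecord F N ζ))
              (WOfRecord₁₃ F N θ lamW)).symm))
    · show upOfRecord₅C F N (θ.view₁₃CoPB10YZW F N Mstar ops ζ lamW) P = _
      rw [Stage13Params.view₁₃CoPB10YZW_eq]
  · exact b11_main_at_view₁₃CoPB10YZW_of_leaf θ Mstar ops ζ lamW (fun _ => rfl) hleaf P

/-! ## §3 On node00-def-K0a's Stage-13 witness line of record `θ₁₃ = theta13LiveOfRecord F N` (θ-level maker, background-free; `L = F.L`, `γ = 1∕2`) -/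
/-- **N07's SHARE ON THE WITNESS LINE OF RECORD** costs the Core provisos AT `θ₁₃` (`hP`, HYPOTHESIS — the K0-class content) and the [B11] leaf at SOME residual layer `ζ` (§2's named
layers display what closes it); admissibility is K0a's THEOREM `admissible_theta13LiveOfRecord`, the window is `γ = 1∕2` (`theta13LiveOfFamily_γ`): a ₁₃CCoP record of
`datumOfRecord₁₃CoP θ₁₃ hP` (`w.L = F.L`) bound to the four-pin CoP view of `θ₁₃` presenting `ζ`, N07 at every run. [cite: Balaban1985Variational, Thm 1 p.279, Props 2–9 pp.281–309; Balaban1987RG1, (0.21) p.256; Balaban1989LargeFieldII, Thm 1 + (0.1) pp.355–356 (bookkeeping)] -/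
theorem exists_record₁₃CCoP_b11_main_at_theta13LiveOfRecord (F : T4Family) (hP : (theta13LiveOfRecord F N).Provisos₁₃Core F N) (Mstar : ℕ)
    (ops : OpsY N (theta13LiveOfRecord F N).toStage3Params Mstar) (ζ : ResidZ F N) (lamW : ResidW F N) (hleaf : B11Leaf (Z11OfRecord F N ζ)) :
    ∃ w : WorldP, IsRecordOfRecord₁₃CCoP F N (datumOfRecord₁₃CoP F N (theta13LiveOfRecord F N) hP) w ∧ w.γ = 1 / 2 ∧ w.L = (F.L : ℝ) ∧
      (∀ P, w.up P = upOfRecord₅C F N ((theta13LiveOfRecord F N).view₁₃CoPB10YZW F N Mstar ops ζ lamW) P) ∧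
      ∀ P : B12.RunParams, Dag.B11_main (leavesP w P) :=
  exists_record₁₃CCoP_b11_main_of_leaf (theta13LiveOfRecord F N) hP (admissible_theta13LiveOfRecord F N) (γw := 1 / 2)
    ⟨one_half_pos, (theta13LiveOfFamily_γ F N _ _ _ _).symm.le⟩ Mstar ops ζ lamW hleaf

/-- **N07's CONJUNCT OF THE STAGE-13 NODES-∃, WITNESSED AT `θ₁₃` OF RECORD, `N = 2`** — from the Core provisos at the witness (`hP`, HYPOTHESIS) and the [B11] leaf at SOME `ζ`: the
guard is K0a's HYPOTHESIS-FREE `ztUnity_theta13LiveOfRecord` ∕ `slotsNondegenerate₁₃_theta13LiveOfRecord_of_hasResiduals`, admissibility its `admissible_theta13LiveOfRecord`, BY NAME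
(junk operator layer, floor `0`, any [IV] layer).  NOT the stub, NOT a discharge. [cite: Balaban1985Variational, Thm 1 p.279, Props 2–9 pp.281–309; Balaban1988Convergent, Thm 1 p.262, (3.16)–(3.22) pp.268–269 (bookkeeping)] -/
theorem exists_guarded_record₁₃CCoP_b11_main_of_theta13Live_provisosCore_two (F : T4Family) (hP : (theta13LiveOfRecord F 2).Provisos₁₃Core F 2)
    (ζ : ResidZ F 2) (hleaf : B11Leaf (Z11OfRecord F 2 ζ)) :
    ∃ (θ : Stage13Params F 2) (h : θ.Provisos₁₃Core F 2) (w : WorldP), (θ.ZtUnity F 2 ∧ θ.SlotsNondegenerate₁₃ F 2) ∧ θ.Admissible F 2 ∧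
      IsRecordOfRecord₁₃CCoP F 2 (datumOfRecord₁₃CoP F 2 θ h) w ∧ ∀ P : B12.RunParams, Dag.B11_main (leavesP w P) := by
  obtain ⟨ops, -, -⟩ := exists_junkOps_b9LeafX_Y9OfRecord (N := 2) (theta13LiveOfRecord F 2).toStage3Params
    (admissible_theta13LiveOfRecord F 2).1.1.1.1.1.1 0
  obtain ⟨lamW⟩ := nonempty_residW F 2
  obtain ⟨w, hR, -, -, -, hN⟩ := exists_record₁₃CCoP_b11_main_at_theta13LiveOfRecord (N := 2) F hP 0 ops ζ lamW hleaf
  exact ⟨_, hP, w, ⟨ztUnity_theta13LiveOfRecord F 2, slotsNondegenerate₁₃_theta13LiveOfRecord_of_hasResiduals F 2⟩, admissible_theta13LiveOfRecord F 2, hR, hN⟩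

/-! ## §4 Census ∕ guards at the Core key — the junk channel `ζ.R` survives RECORD 13 (the four-pin view pins `Z`, not `R`'s objects); the ∃-form at the view IS the leaf -/
/-- **A ₁₃CCoP RECORD PRESENTED BY GIVEN `ops`, `ζ`, `λW`, in-edge `b8` VACUOUS**: every admissible Stage-13 `θ` with the Core provisos, any window and floor present a ₁₃CCoP record of
the SAME datum ([B8] indices RE-BOUND EMPTY by n10-d's `Stage13Params.rebindX` — `Provisos₁₃Core.rebindX`, `datumOfRecord₁₃CoP_rebindX`; `B11LeafUnpinnedRecord.b8LeafR_of_isEmpty`), world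
bound to the four-pin CoP view of the re-bound parameter: at every run `b8` HOLDS, `b9 ⟺ B9LeafX (Y9OfRecord …)`, `b11 ⟺ B11Leaf (Z11OfRecord F N ζ)`. [cite: Balaban1985Variational, Thm 1 p.279; Balaban1985BackgroundPropagators, Thm 3.1 p.397; Balaban1985RegularSpaces, Lemma 1 – Thm 8 pp.79–101 (bookkeeping)] -/
theorem exists_record₁₃CCoP_faces (θ : Stage13Params F N) (h : θ.Provisos₁₃Core F N) (hθ : θ.Admissible F N) {γw : ℝ} (hγw : 0 < γw ∧ γw ≤ θ.γ) (Mstar : ℕ)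
    (ops : OpsY N θ.toStage3Params Mstar) (ζ : ResidZ F N) (lamW : ResidW F N) :
    ∃ w : WorldP, IsRecordOfRecord₁₃CCoP F N (datumOfRecord₁₃CoP F N θ h) w ∧ ∀ P : B12.RunParams,
      (leavesP w P).b8 ∧ ((leavesP w P).b9 ↔ B9LeafX (Y9OfRecord N θ.toStage3Params Mstar ops)) ∧
        ((leavesP w P).b11 ↔ B11Leaf (Z11OfRecord F N ζ)) := by
  let X' : B12.RunParams → PrintedCarriersR := fun P =>
    { θ.res.X P with
      I8a := PEmpty, I8b := PEmpty, I8c := PEmpty, I8d := PEmpty, loc8 := fun i => i.elim, fam8 := fun i => i.elim,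
      lan8 := fun i => i.elim, cub8 := fun i => i.elim, toAxial8 := fun i => i.elim, C140 := fun i => i.elim, InR := fun i => i.elim,
      proj140 := fun i => i.elim }
  let θ' : Stage13Params F N := θ.rebindX F N X'
  have h' : θ'.Provisos₁₃Core F N := h.rebindX X'
  have hθ' : θ'.Admissible F N := (Stage13Params.rebindX_admissible_iff F N θ X').2 hθ
  have hD : datumOfRecord₁₃CoP F N θ' h' = datumOfRecord₁₃CoP F N θ h := datumOfRecord₁₃CoP_rebindX F N θ h X' h'
  obtain ⟨w₀⟩ := nonempty_worldP
  refine ⟨{ w₀ with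
      C := (datumOfRecord₁₃CoP F N θ' h').C, γ := γw, L := (θ.L : ℝ), one_lt_L := by exact_mod_cast θ.hL.2,
      up := fun P => upOfRecord₅C F N (θ'.view₁₃CoPB10YZW F N Mstar ops ζ lamW) P }, ?_, fun P => ?_⟩
  · rw [← hD]
    exact isRecordOfRecord₁₃CCoP_of_up_view₁₃CoPB10YZW θ' h' hθ' Mstar ops ζ lamW _ rfl hγw rfl (fun _ => rfl)
  · have hl := upOfRecord₅C_view₁₃CoPB10YZW_leaves F N θ' Mstar ops ζ lamW P
    refine ⟨?_, hl.2.1, hl.2.2.2⟩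
    exact (B11LeafUnpinnedRecord.upOfRecord₅C_b8_b9_b11 (θ'.view₁₃CoPB10YZW F N Mstar ops ζ lamW) P).1.2
      (@B11LeafUnpinnedRecord.b8LeafR_of_isEmpty _ _ _ _ (inferInstance : IsEmpty PEmpty) (inferInstance : IsEmpty PEmpty)
        (inferInstance : IsEmpty PEmpty) (inferInstance : IsEmpty PEmpty) _ _ _ _ _ _ _ _ _ _ _ _ _ _ _)

/-- **THE ∀-FORM FORCES THE [B11] LEAF AT THE BUNDLE OF RECORD OF EVERY RESIDUAL LAYER**: at the record of `exists_record₁₃CCoP_faces` with n22-b's JUNK operator layer and any [IV]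
layer the in-edges hold, so N07 there IS the leaf. [cite: Balaban1985Variational, Thm 1 p.279 (bookkeeping)] -/
theorem b11Leaf_of_s_N07_record₁₃CCoP (hS : S_N07 (fun F D w => IsRecordOfRecord₁₃CCoP F N D w))
    (θ : Stage13Params F N) (h : θ.Provisos₁₃Core F N) (hθ : θ.Admissible F N) (hγ : 0 < θ.γ) (ζ : ResidZ F N) : B11Leaf (Z11OfRecord F N ζ) := by
  obtain ⟨ops, -, hops⟩ := exists_junkOps_b9LeafX_Y9OfRecord (N := N) θ.toStage3Params hθ.1.1.1.1.1.1 0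
  obtain ⟨lamW⟩ := nonempty_residW F N
  obtain ⟨w, hw, hl⟩ := exists_record₁₃CCoP_faces θ h hθ (γw := θ.γ) ⟨hγ, le_rfl⟩ 0 ops ζ lamW
  let P₀ : B12.RunParams := ⟨0, 0, 0⟩
  obtain ⟨h8, h9, h11⟩ := hl P₀
  exact h11.1 ((b11_main_iff_leaves_of_isRecordOfRecord₁₃CCoP hw P₀).1 (hS F _ w hw P₀) h8 (h9.2 hops))

/-- **… HENCE THE ∀-FORM ASSERTS THEOREM 1 AT NODE 00's OBJECTS FOR EVERY RESIDUAL REGULARITY DATUM `R`** — degenerate data included, which is absurd (next theorem). [cite: Balaban1985Variational, Thm 1 (9)–(10) p.279 (bookkeeping: the typed regularity clause reads residual data)] -/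
theorem thm1_family_of_s_N07_record₁₃CCoP (hS : S_N07 (fun F D w => IsRecordOfRecord₁₃CCoP F N D w))
    (θ : Stage13Params F N) (h : θ.Provisos₁₃Core F N) (hθ : θ.Admissible F N) (hγ : 0 < θ.γ) (R : ∀ i : ZIdx, RegCarrierT F N i.K) :
    ∃ C : B11Thm1.Consts, ∀ i : ZIdx, Thm1At C (varProblemT F N i.K i.k (R i)) := by
  obtain ⟨ζ₀⟩ := nonempty_residZ F N
  exact exists_thm1At_of_b11Leaf_Z11OfRecord (b11Leaf_of_s_N07_record₁₃CCoP hS θ h hθ hγ { ζ₀ with R := R })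

/-- ★ **`S_N07` AT `Rec := IsRecordOfRecord₁₃CCoP` IS FALSE as soon as ONE admissible Stage-13 parameter with the Core provisos and `γ > 0` exists** — i.e. MODULO Core inhabitation (neither assumed nor refuted here) — through g30's refuting residual
layer `exists_residZ_not_b11Leaf`: a K1 knit must NOT instantiate `S_N07` at the Core key in ∀-form; the junk channel is the residual regularity datum `ζ.R` (F8), NOT the criticality slot (pinned) nor the Sect.-E ∕ G data (presented). [cite:
Balaban1985Variational, Thm 1 p.279 (bookkeeping: the universal form over the record is refutable through the residual layer)] -/
theorem not_s_N07_record₁₃CCoP_of_params (θ : Stage13Params F N) (h : θ.Provisos₁₃Core F N) (hθ : θ.Admissible F N) (hγ : 0 < θ.γ) :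
    ¬ S_N07 (fun F D w => IsRecordOfRecord₁₃CCoP F N D w) := fun hS => by
  obtain ⟨ζ, hζ⟩ := exists_residZ_not_b11Leaf F N
  exact hζ (b11Leaf_of_s_N07_record₁₃CCoP hS θ h hθ hγ ζ)

/-- **Given ONE ₁₃CCoP record, a ₁₃CCoP record of the SAME datum at every run of which `b8`, `b9` HOLD and N07 FAILS** (junk operator layer, refuting residual [B11] layer, empty [B8]
indices, any [IV] layer). [cite: Balaban1985Variational, Thm 1 p.279 (bookkeeping over NODE 00's Stage-13 CoP record)] -/
theorem exists_record₁₃CCoP_not_b11_main (hR : IsRecordOfRecord₁₃CCoP F N D w) :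
    ∃ w' : WorldP, IsRecordOfRecord₁₃CCoP F N D w' ∧ ∀ P : B12.RunParams, ¬ Dag.B11_main (leavesP w' P) := by
  obtain ⟨θ, h, hθ, hD, -, hγ, -, -⟩ := hR
  obtain ⟨ops, -, hops⟩ := exists_junkOps_b9LeafX_Y9OfRecord (N := N) θ.toStage3Params hθ.1.1.1.1.1.1 0
  obtain ⟨ζ, hζ⟩ := exists_residZ_not_b11Leaf F N
  obtain ⟨lamW⟩ := nonempty_residW F N
  obtain ⟨w', hw', hl⟩ := exists_record₁₃CCoP_faces θ h hθ (γw := w.γ) hγ 0 ops ζ lamW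
  refine ⟨w', by rw [hD]; exact hw', fun P hN => ?_⟩
  obtain ⟨h8, h9, h11⟩ := hl P
  exact hζ (h11.1 ((b11_main_iff_leaves_of_isRecordOfRecord₁₃CCoP hw' P).1 hN h8 (h9.2 hops)))

/-- **`S_N07` at the Core key is FALSE relative to ONE ₁₃CCoP record** (any family; the record certifies `θ`, its Core provisos, admissibility and `0 < w.γ ≤ θ.γ`; whether such a
record EXISTS is the K0-class question — not reached for here). [cite: Balaban1985Variational, Thm 1 p.279 (bookkeeping)] -/
theorem not_s_N07_record₁₃CCoP (hex : ∃ (F : T4Family) (D : Datum F N) (w : WorldP), IsRecordOfRecord₁₃CCoP F N D w) :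
    ¬ S_N07 (fun F D w => IsRecordOfRecord₁₃CCoP F N D w) := by
  obtain ⟨F, D, w, θ, h, hθ, -, -, hγ, -, -⟩ := hex
  exact not_s_N07_record₁₃CCoP_of_params θ h hθ (hγ.1.trans_le hγ.2)

/-- ★ **AT THE JUNK-OPS ∕ EMPTY-[B8] FOUR-PIN PRESENTATION N07 IS EXACTLY THE [B11] LEAF AT THE BUNDLE OF RECORD** (every admissible Stage-13 `θ` with the Core provisos, any
window, every floor, `ζ`, `λW`).  NOT junk-closable: its `t1` is Theorem 1 at NODE 00's OBJECTS over the inhabited `ZIdx` (`k = 0`: `CarriersZ.famV_levelZero_exists8_unique6`;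
`k ≥ 1`: Bałaban's theorem, GAPS G₈a-1∕2) — the measured form the rung's cure (a) adopts. [cite: Balaban1985Variational, Thm 1 p.279, Props 2–9 pp.281–309] -/
theorem exists_record₁₃CCoP_b11_main_iff_leaf (θ : Stage13Params F N) (h : θ.Provisos₁₃Core F N) (hθ : θ.Admissible F N) {γw : ℝ} (hγw : 0 < γw ∧ γw ≤ θ.γ)
    (Mstar : ℕ) (ζ : ResidZ F N) (lamW : ResidW F N) :
    ∃ w : WorldP, IsRecordOfRecord₁₃CCoP F N (datumOfRecord₁₃CoP F N θ h) w ∧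
      ∀ P : B12.RunParams, Dag.B11_main (leavesP w P) ↔ B11Leaf (Z11OfRecord F N ζ) := by
  obtain ⟨ops, -, hops⟩ := exists_junkOps_b9LeafX_Y9OfRecord (N := N) θ.toStage3Params hθ.1.1.1.1.1.1 Mstar
  obtain ⟨w, hw, hl⟩ := exists_record₁₃CCoP_faces θ h hθ hγw Mstar ops ζ lamW
  refine ⟨w, hw, fun P => ?_⟩
  obtain ⟨h8, h9, h11⟩ := hl P
  rw [b11_main_iff_leaves_of_isRecordOfRecord₁₃CCoP hw P, ← h11]
  exact ⟨fun hN => hN h8 (h9.2 hops), fun hb _ _ => hb⟩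

/-! ## §5 The BARE Core key does not measure N07 (AUDIT-A2b for N07, certified) — the four-pin view (§1) does -/
/-- **N07 JUNK-CLOSED AT THE BARE CORE KEY**: every admissible Stage-13 `θ` with the Core provisos, any window, presents a ₁₃CCoP record of the SAME datum whose world is bound to the Stage-13 CoP view of `θ.pinZ Z∅`, `Z∅` the [B11] bundle with EMPTY
index (`I11 := PEmpty`, constants `1`): there `b11` holds outright (`B11LeafKnitProp9.b11Leaf_of_isEmpty` — Thm 1 and Props 2–9 READ AT NOTHING) — dag-ref-G's AUDIT-A2b witness species for N07 in kernel (n10-d's `Provisos₁₃Core.pinZ`,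
`datumOfRecord₁₃CoP_pinZ`, `toStage5₁₃CoP_pinZ`, `upOfRecord₅C_pinZ_b11_iff`). [cite: Balaban1985Variational, Thm 1 p.279, Props 2–9 pp.281–309 (bookkeeping: vacuity at an empty carrier)] -/
theorem exists_record₁₃CCoP_b11_main_of_pinZ_empty (θ : Stage13Params F N) (h : θ.Provisos₁₃Core F N) (hθ : θ.Admissible F N) {γw : ℝ} (hγw : 0 < γw ∧ γw ≤ θ.γ) :
    ∃ (Z₀ : PrintedCarriers11) (w : WorldP), IsEmpty Z₀.I11 ∧ IsRecordOfRecord₁₃CCoP F N (datumOfRecord₁₃CoP F N θ h) w ∧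
      (∀ P, w.up P = upOfRecord₅C F N ((θ.pinZ F N Z₀).toStage5₁₃CoP F N) P) ∧ ∀ P : B12.RunParams, Dag.B11_main (leavesP w P) := by
  let Z₀ : PrintedCarriers11 :=
    ⟨PEmpty, fun i => i.elim, fun i => i.elim, fun i => i.elim, fun i => i.elim, 1, 1, 1, 1, 1, 1, 1, 1, 1, 1, 1, 1⟩
  have hZ : IsEmpty Z₀.I11 := (inferInstance : IsEmpty PEmpty)
  obtain ⟨w₀⟩ := nonempty_worldP
  refine ⟨Z₀, { w₀ with
      C := (datumOfRecord₁₃CoP F N θ h).C, γ := γw, L := (θ.L : ℝ), one_lt_L := by exact_mod_cast θ.hL.2,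
      up := fun P => upOfRecord₅C F N ((θ.pinZ F N Z₀).toStage5₁₃CoP F N) P }, hZ, ?_, fun _ => rfl, fun P => ?_⟩
  · exact ⟨θ.pinZ F N Z₀, h.pinZ Z₀, (Stage13Params.pinZ_admissible_iff F N θ Z₀).2 hθ, (datumOfRecord₁₃CoP_pinZ F N θ h Z₀).symm,
      rfl, hγw, rfl, fun _ => rfl⟩
  · intro _ _ _ _ _
    show (upOfRecord₅C F N ((θ.pinZ F N Z₀).toStage5₁₃CoP F N) P).b11
    rw [Stage13Params.toStage5₁₃CoP_pinZ]
    exact (upOfRecord₅C_pinZ_b11_iff F N (θ.toStage5₁₃CoP F N) Z₀ P).2 (B11LeafKnitProp9.b11Leaf_of_isEmpty Z₀ hZ)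

/-- ★ **N07 IS UNDETERMINED OVER THE BARE CORE KEY** (₁₃CoP image of p522100's; lineage p450629 `b11_main_undetermined_over_record₁₁C`): every admissible Stage-13 `θ` with the Core provisos and `γ > 0` presents, over the SAME datum, one ₁₃CCoP record
at every run of which N07 HOLDS (empty [B11] index) and one at every run of which N07 FAILS (junk `ops`, refuting `ζ`, empty [B8] — §4): a rung keyed on the bare record measures nothing of N07; the four-pin view (§1, cure (a)) does. [cite:
Balaban1985Variational, Thm 1 p.279, Props 2–9 pp.281–309 (bookkeeping: the bare record pins no [B11] carrier)] -/
theorem b11_main_undetermined_over_record₁₃CCoP (θ : Stage13Params F N) (h : θ.Provisos₁₃Core F N) (hθ : θ.Admissible F N) (hγ : 0 < θ.γ) :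
    (∃ w : WorldP, IsRecordOfRecord₁₃CCoP F N (datumOfRecord₁₃CoP F N θ h) w ∧ ∀ P : B12.RunParams, Dag.B11_main (leavesP w P)) ∧
      ∃ w : WorldP, IsRecordOfRecord₁₃CCoP F N (datumOfRecord₁₃CoP F N θ h) w ∧ ∀ P : B12.RunParams, ¬ Dag.B11_main (leavesP w P) := by
  obtain ⟨-, w, -, hw, -, hN⟩ := exists_record₁₃CCoP_b11_main_of_pinZ_empty θ h hθ (γw := θ.γ) ⟨hγ, le_rfl⟩
  obtain ⟨w₁, hw₁, -⟩ := exists_world_isRecordOfRecord₁₃CCoP F N θ h hθ (γw := θ.γ) ⟨hγ, le_rfl⟩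
  exact ⟨⟨w, hw, hN⟩, exists_record₁₃CCoP_not_b11_main hw₁⟩

end Summit.QuantumFields.YangMills.BalabanUVNodes.N07AtRecord13CoP

end
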